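import Mathlib
import Literature.Computability.AlgebraicComplexity.ASSS16SparseLeafMinors
import Literature.Computability.AlgebraicComplexity.FSV18JacobianCriterionPosChar
import Literature.Algebra.Polynomial.JacobianCriterion
import HarnessLib

/-!
# First-order extraction from one Vandermonde block: `Ψ(C) = 0 ⟹ Ψ'(∂_m C) = 0` for every
# coefficient variable `m` — proofs only (val-lit p2 g9; FSV Thm. 48 for UNBOUNDED top fan-in)

[ASSS16] (Agrawal–Saha–Saptharishi–Saxena, *Jacobian hits circuits*, arXiv:1111.0582, §4, proof of
Thm. `thm:dDkrPIT`, locator paper:arxiv-1111.0582 p0009.txt:L3–L22) reduce a depth-`D` occur-`k`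
formula `C` with an arbitrary top `+` gate to top fan-in `≤ 2k` by a hitting-SET step: "`C(x + e_i) -
C(x)` … has top fanin at most `2k`", after which the faithful-homomorphism recursion (Lemma 4.2,
Cor. 4.3) is run. Forbes–Shpilka–Volk [ForbesShpilkaVolk2018] Thm. 48 (= ToC Thm. 5.24) quote the
result as a GENERATOR statement for the whole class with `D - 2` Vandermonde blocks
`Σ_{j ≤ r_ℓ} y_{j,ℓ} t_ℓ^{i j}` on top of an abstract sparse-hitting `Φ` (tree: `FSV2018_thm48`,
`AC/FSV18SuccinctGenerators.lean`; provenance caveat B21 of the val-lit cell: the generator form for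
unbounded top fan-in is not literally covered by the printed proof).

This file supplies the generator-form replacement of the hitting-set step, which costs exactly ONE
seed of ONE Vandermonde block (`vdmGenCoeff F n r`, `r ≥ 1`): if
`C(Vdm_r(y,t) ⊕ Ψ') = 0` then, differentiating in the first seed `y_0`
(chain rule, `∂_{y_0} Vdm_r(y,t)_m = t^{i_m}`, `i_m = binIndex m`, the tree's
`JacobianCriterion.pderiv_aeval`), killing the remaining `y`-seeds, and comparing coefficients of the
distinct powers `t^{i_m}` (`binIndex` is injective: `binIndex_eq_binaryOrder_symm_succ`), one gets
`Ψ'(∂_m C) = 0` for EVERY `m` (`ASSS16.map_pderiv_eq_zero_of_aeval_vdmBlock_add_eq_zero`). Since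
`∂_m C = Σ_{u : x_m occurs in T_u} ∂_m T_u` has at most `k` summands for an occur-`k` formula
`C = Σ_u T_u`, this hands the bounded-fan-in machinery a family of `≤ k` first-order derivatives
(consumer: `AC/FSV18Thm48Holds.lean`). Also here: the elementary "a polynomial involving a variable,
of degree below the characteristic, has a non-zero partial derivative in it"
(`pderiv_ne_zero_of_mem_vars_of_clause`, from val-lit t18's
`notMem_vars_of_pderiv_eq_zero_of_cast_ne_zero`).

Theorem-only; no definitions, no named facts. Honest framing: an elementary device (first-order
Taylor coefficient along the moment curve) in support of the N1 record `FSV2018_thm48`; `VP ≠ VNP`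
is NOT proved and nothing here bears on it.

## References
* [AgrawalEtAl2011] M. Agrawal, C. Saha, R. Saptharishi, N. Saxena, *Jacobian hits circuits*,
  arXiv:1111.0582 (STOC 2012 / SICOMP 45 (2016)), §4, proof of Thm. dDkrPIT (the top-fan-in
  reduction), locator paper:arxiv-1111.0582 p0009.txt:L3–L22; Lemma 2.2 (the Vandermonde block (2)).
* [ForbesShpilkaVolk2018] M. A. Forbes, A. Shpilka, B. L. Volk, *Succinct hitting sets and barriers to
  proving lower bounds for algebraic circuits*, ToC 14 (2018), Thm. 48 (seq.) = ToC Thm. 5.24 and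
  Prop. 17 (the index `i_m = 1 + Σ_{k ∈ m} 2^k`).
-/

noncomputable section

namespace Literature.Computability.AlgebraicComplexity

namespace ASSS16

open MvPolynomial Finset

open scoped BigOperators

variable {F : Type*} [Field F]

/-! ### Coefficient extraction against distinct powers of a fresh variable -/

/-- If `t ∉ vars p` then every monomial with a positive `t`-exponent has coefficient `0` in `p`.
[folklore] -/
private theorem coeff_eq_zero_of_notMem_vars_of_ne {σ : Type*} {t : σ} {p : MvPolynomial σ F}
    (ht : t ∉ p.vars) {d : σ →₀ ℕ} (hd : d t ≠ 0) : coeff d p = 0 := by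
  classical
  by_contra h
  exact ht ((mem_vars_iff_mem_support t).2 ⟨d, mem_support_iff.2 h, Finsupp.mem_support_iff.2 hd⟩)

/-- **Comparing coefficients of distinct powers of a fresh variable:** if
`Σ_{i ∈ S} a_i · t^{e_i} = 0` with the exponents `e_i` pairwise distinct on `S` and `t` not occurring
in any `a_i`, then every `a_i` vanishes (the step "the exponents `i_m·j` are distinct" of the
Vandermonde block). [cite: AgrawalEtAl2011, Lemma 2.2 (proof, §7.1: the Vandermonde matrix of the block)]
locator: paper:arxiv-1111.0582 p0017.txt:L56–L100 -/
theorem eq_zero_of_sum_mul_X_pow_eq_zero {σ ι : Type*} (t : σ) (S : Finset ι)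
    (a : ι → MvPolynomial σ F) (e : ι → ℕ) (he : Set.InjOn e S)
    (ht : ∀ i ∈ S, t ∉ (a i).vars) (h : ∑ i ∈ S, a i * X t ^ e i = 0) :
    ∀ i ∈ S, a i = 0 := by
  classical
  intro i₀ hi₀
  ext d
  rw [coeff_zero]
  by_cases hdt : d t = 0
  swap
  · exact coeff_eq_zero_of_notMem_vars_of_ne (ht i₀ hi₀) hdt
  -- read off the coefficient of `d + e_{i₀}·t` in the vanishing sum
  have hsum := congrArg (coeff (d + Finsupp.single t (e i₀))) h
  rw [coeff_sum, coeff_zero] at hsum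
  rw [Finset.sum_eq_single i₀] at hsum
  · rwa [X_pow_eq_monomial, coeff_mul_monomial', if_pos le_add_self, add_tsub_cancel_right,
      mul_one] at hsum
  · intro i hi hne
    rw [X_pow_eq_monomial, coeff_mul_monomial']
    split_ifs with hle
    · rw [mul_one]
      refine coeff_eq_zero_of_notMem_vars_of_ne (ht i hi) ?_
      have hei : e i ≠ e i₀ := fun hh => hne (he hi hi₀ hh)
      have h1 : e i ≤ e i₀ := by
        have := hle t
        simp only [Finsupp.single_eq_same, Finsupp.coe_add, Pi.add_apply, hdt, zero_add] at this
        exact this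
      simp only [Finsupp.coe_tsub, Finsupp.coe_add, Pi.sub_apply, Pi.add_apply,
        Finsupp.single_eq_same, hdt, zero_add]
      omega
    · rfl
  · intro h0
    exact absurd hi₀ h0

/-! ### The first seed of a Vandermonde block extracts the gradient -/

/-- `∂_{y_0}` of the Vandermonde block `Σ_{j<r} y_j t^{(j+1)·i_m}` is `t^{i_m}`.
[cite: AgrawalEtAl2011, Lemma 2.2 (the block (2), its Jacobian in `y` is the Vandermonde matrix)]
locator: paper:arxiv-1111.0582 p0017.txt:L60–L70 -/
theorem pderiv_inl_zero_vdmGenCoeff {n r : ℕ} (hr : 0 < r) (m : Fin n →₀ ℕ) :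
    pderiv (Sum.inl ⟨0, hr⟩) (vdmGenCoeff F n r m) =
      X (Sum.inr ()) ^ binIndex m := by
  classical
  rw [vdmGenCoeff, map_sum]
  have hpow : ∀ e : ℕ, pderiv (Sum.inl ⟨0, hr⟩)
      ((X (Sum.inr ()) : MvPolynomial (Fin r ⊕ Unit) F) ^ e) = 0 := by
    intro e
    refine pderiv_eq_zero_of_notMem_vars fun hv => ?_
    have := vars_pow _ _ hv
    rw [vars_X] at this
    simp at this
  rw [Finset.sum_eq_single (⟨0, hr⟩ : Fin r)]
  · rw [pderiv_mul, pderiv_X_self, one_mul, hpow, mul_zero, add_zero]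
    simp
  · intro j _ hj
    rw [pderiv_mul, pderiv_X_of_ne (fun hh => hj (Sum.inl_injective hh)), zero_mul, hpow,
      mul_zero, add_zero]
  · intro h0
    exact absurd (Finset.mem_univ _) h0

/-- **Extraction.** Let `Ψ : x_m ↦ Vdm_r(y,t)_m + Ψ'(x_m)` with `r ≥ 1`, the block on seeds
`emb : Fin r ⊕ Unit ↪ σ` not occurring in `Ψ'`. If `Ψ(C) = 0` then `Ψ'(∂_m C) = 0` for every
coefficient variable `x_m` — the generator-form counterpart of [ASSS16]'s top-fan-in reduction
("`C(x + e_i) - C(x)` … has top fanin at most `2k`"): differentiate in `y_0` (chain rule), set the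
`y`'s to `0`, and compare coefficients of the distinct powers `t^{i_m}`.
[cite: AgrawalEtAl2011, §4 (proof of Thm. dDkrPIT, first paragraph) with Lemma 2.2 (the block); ForbesShpilkaVolk2018, Thm. 48 (seq.) = ToC Thm. 5.24 (the `D-2` blocks)]
locator: paper:arxiv-1111.0582 p0009.txt:L3–L22 -/
theorem map_pderiv_eq_zero_of_aeval_vdmBlock_add_eq_zero {n r : ℕ} {σ : Type*}
    (Ψ' : MvPolynomial (multilinearMonomials n) F →ₐ[F] MvPolynomial σ F)
    (emb : Fin r ⊕ Unit → σ) (hemb : Function.Injective emb)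
    (hfresh : ∀ mm : multilinearMonomials n, ∀ v ∈ (Ψ' (X mm)).vars, v ∉ Set.range emb)
    (hr : 0 < r) (P : MvPolynomial (multilinearMonomials n) F)
    (h : aeval (fun mm : multilinearMonomials n =>
        rename emb (vdmGenCoeff F n r (mm : Fin n →₀ ℕ)) + Ψ' (X mm)) P = 0) :
    ∀ mm : multilinearMonomials n, Ψ' (pderiv mm P) = 0 := by
  classical
  haveI : Fintype (multilinearMonomials n) := Fintype.ofEquiv (Fin (2 ^ n)) (binaryOrder n)
  set g : multilinearMonomials n → MvPolynomial σ F := fun mm =>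
    rename emb (vdmGenCoeff F n r (mm : Fin n →₀ ℕ)) + Ψ' (X mm) with hg
  set y0 : σ := emb (Sum.inl ⟨0, hr⟩) with hy0
  set tt : σ := emb (Sum.inr ()) with htt
  -- `Ψ'` is substitution of its values on the variables
  have hΨ'b : ∀ Q, Ψ' Q = bind₁ (fun mm : multilinearMonomials n => Ψ' (X mm)) Q := by
    intro Q
    rw [← aeval_eq_bind₁]
    exact DFunLike.congr_fun (aeval_unique Ψ') Q
  -- (1) `∂_{y_0} g(m) = t^{i_m}`
  have hgy : ∀ mm : multilinearMonomials n,
      pderiv y0 (g mm) = X tt ^ binIndex (mm : Fin n →₀ ℕ) := by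
    intro mm
    rw [hg]
    simp only
    rw [map_add, hy0, pderiv_rename hemb, pderiv_inl_zero_vdmGenCoeff hr, map_pow, rename_X,
      pderiv_eq_zero_of_notMem_vars (fun hv => hfresh mm _ hv ⟨_, rfl⟩), add_zero]
  -- (2) the chain rule applied to `Ψ(P) = 0`
  have hchain : ∑ mm : multilinearMonomials n,
      aeval g (pderiv mm P) * X tt ^ binIndex (mm : Fin n →₀ ℕ) = 0 := by
    have h1 := congrArg (pderiv y0) h
    rw [map_zero, Literature.Algebra.Polynomial.JacobianCriterion.pderiv_aeval] at h1
    simpa only [hgy] using h1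
  -- (3) kill the `y`-seeds: `κ : y_j ↦ 0`, every other variable fixed
  let κ : MvPolynomial σ F →ₐ[F] MvPolynomial σ F :=
    aeval fun v => if v ∈ Set.range (emb ∘ Sum.inl) then 0 else X v
  have hκΨ : ∀ Q, κ (Ψ' Q) = Ψ' Q := by
    intro Q
    have hvars : ∀ v ∈ (Ψ' Q).vars, v ∉ Set.range emb := by
      intro v hv
      rw [hΨ'b Q] at hv
      obtain ⟨mm, -, hmm⟩ := Finset.mem_biUnion.1 (vars_bind₁ _ _ hv)
      exact hfresh mm v hmm
    change κ.toRingHom (Ψ' Q) = (RingHom.id _) (Ψ' Q)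
    refine hom_congr_vars ?_ (fun v hv _ => ?_) rfl
    · ext a
      simp [κ]
    · have hv' : v ∉ Set.range (emb ∘ Sum.inl) := by
        rintro ⟨j, rfl⟩
        exact hvars _ hv ⟨Sum.inl j, rfl⟩
      show κ (X v) = X v
      simp only [κ, aeval_X, if_neg hv']
  have hκt : κ (X tt) = X tt := by
    have htt' : tt ∉ Set.range (emb ∘ Sum.inl) := by
      rintro ⟨j, hj⟩
      exact Sum.inl_ne_inr (hemb hj)
    simp only [κ, aeval_X, if_neg htt']
  have hκg : ∀ mm, κ (g mm) = Ψ' (X mm) := by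
    intro mm
    rw [hg]
    simp only
    rw [map_add, hκΨ, vdmGenCoeff, map_sum, map_sum, Finset.sum_eq_zero, zero_add]
    intro j _
    rw [map_mul, rename_X, map_mul]
    have : κ (X (emb (Sum.inl j))) = 0 := by
      have hj : emb (Sum.inl j) ∈ Set.range (emb ∘ Sum.inl) := ⟨j, rfl⟩
      simp only [κ, aeval_X, if_pos hj]
    rw [this, zero_mul]
  have hκaeval : ∀ Q : MvPolynomial (multilinearMonomials n) F, κ (aeval g Q) = Ψ' Q := by
    intro Q
    rw [show κ (aeval g Q) = (κ.comp (aeval g)) Q from rfl, comp_aeval]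
    have : (fun i => κ (g i)) = fun i => Ψ' (X i) := funext hκg
    rw [this]
    exact DFunLike.congr_fun (aeval_unique Ψ').symm Q
  have hsum : ∑ mm : multilinearMonomials n,
      Ψ' (pderiv mm P) * X tt ^ binIndex (mm : Fin n →₀ ℕ) = 0 := by
    have h2 := congrArg κ hchain
    rw [map_zero, map_sum] at h2
    simpa only [map_mul, map_pow, hκaeval, hκt] using h2
  -- (4) compare coefficients of the distinct powers `t^{i_m}`
  have hinj : Set.InjOn (fun mm : multilinearMonomials n => binIndex (mm : Fin n →₀ ℕ))
      (Finset.univ : Finset (multilinearMonomials n)) := by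
    intro a _ b _ hab
    simp only [binIndex_eq_binaryOrder_symm_succ, add_left_inj] at hab
    exact (binaryOrder n).symm.injective (Fin.ext hab)
  have htfresh : ∀ mm ∈ (Finset.univ : Finset (multilinearMonomials n)),
      tt ∉ (Ψ' (pderiv mm P)).vars := by
    intro mm _ hv
    rw [hΨ'b] at hv
    obtain ⟨mm', -, hmm'⟩ := Finset.mem_biUnion.1 (vars_bind₁ _ _ hv)
    exact hfresh mm' tt hmm' ⟨Sum.inr (), rfl⟩
  intro mm
  exact eq_zero_of_sum_mul_X_pow_eq_zero tt Finset.univ (fun mm => Ψ' (pderiv mm P))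
    (fun mm => binIndex (mm : Fin n →₀ ℕ)) hinj htfresh hsum mm (Finset.mem_univ mm)

/-! ### A polynomial of degree below the characteristic has non-zero partials in its variables -/

/-- The exponents `1, …, e ≤ d` are non-zero in `F` when `char F = 0` or `char F > d`. [folklore] -/
private theorem natCast_ne_zero_of_clause {d e : ℕ} (hchar : ringChar F = 0 ∨ d < ringChar F)
    (h1 : 1 ≤ e) (he : e ≤ d) : (e : F) ≠ 0 := by
  intro h0
  have hdvd : ringChar F ∣ e := (ringChar.spec F e).1 h0
  rcases hchar with hc | hc
  · rw [hc, zero_dvd_iff] at hdvd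
    omega
  · exact absurd (Nat.le_of_dvd (by omega) hdvd) (by omega)

/-- **A polynomial involving some variable has a non-zero partial derivative in that variable**,
provided `char F = 0` or `char F >` its total degree (the hypothesis under which [ASSS16] pass from
"`C` non-constant" to a non-zero difference / derivative: "assuming `char = 0` or `> s^R`").
[cite: AgrawalEtAl2011, §4 (proof of Thm. dDkrPIT: "Assuming that `p` depends on `x_i`" and the characteristic clause)]
locator: paper:arxiv-1111.0582 p0009.txt:L3–L10; p0010.txt:L60–L62 -/
theorem pderiv_ne_zero_of_mem_vars_of_clause {σ : Type*} {P : MvPolynomial σ F} {i : σ}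
    (hi : i ∈ P.vars) (hchar : ringChar F = 0 ∨ P.totalDegree < ringChar F) :
    pderiv i P ≠ 0 := fun h0 =>
  notMem_vars_of_pderiv_eq_zero_of_cast_ne_zero h0
    (fun _ h1 he => natCast_ne_zero_of_clause hchar h1 he) hi

end ASSS16

end Literature.Computability.AlgebraicComplexity
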